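import Summits.QuantumFields.YangMills.Theorems.BalabanUVNodesN15KingModelCombesThomasFormBound
import Summits.QuantumFields.YangMills.Theorems.BalabanUVNodesN15KingModelComplexLinkOperator
import HarnessLib

/-!
# BalabanUVNodes ∕ N15 — THE KING-MODEL RUNG (PART Ϩ-c): THE `H¹` PERTURBATION BOUND FOR A TWO-SIDED COMPLEX PERTURBATION OF THE LINK FIELD — the hopping matrix `T_{δU,δV}` of a
# perturbation `(δU, δV)` around a UNITARY base field `U₀` is form-bounded by the covariant Dirichlet form of `U₀` with TWO parameters: the size `ε₁ = sup‖δU_b‖, ‖δV_b‖` (pairs with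
# a covariant GRADIENT) and the ZEROTH-ORDER DEFECT `ε₂ = sup‖δU_b·U₀_bᴴ + U₀_b·δV_b‖` (pairs with the field itself); `ε₂ = 2ε₁` in general (two-sided), `ε₂ = ε₁²` on the unitary slice
# (Track A, DAG node N15 = NE2; FAN-OUT v1.1 §N15 s3 «KING-MODEL RUNG … + what the curved case adds»; count-neutral)

HONEST FRAMING.  Count-neutral (cell `pub-ymgap`, seat `pub-ymgap-dag-n15-e` g51; `--supports stmt-QuantumFields-27247 --as helper` = K3ᴬ, KEY MAP v3).  Elementary estimate on King's
carrier `Tor K × n` (any torus, any fibre) for PART Ϛ-a's two-sided hopping matrix `cxHop K c δU δV`; PART Ϧ-g's unitary bond-pair identity `DUᴴ + UDᴴ = DDᴴ` is the special case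
`δU = U − U₀`, `δV = (U − U₀)ᴴ` with `U` unitary.  THIS is the estimate that separates the two complex windows of [B9] §3.B in King's model: PART Ϛ-d proved the two-sided window
`2(d+1)cε < m²` (= `O(η²)` in King's scaling `c = L²`) SHARP — because two-sided perturbations have `ε₂ = 2ε₁` (first order); on print's slice `V = U⁻¹` the defect is `ε₂ = O(ε₁²)`
(PART Ϩ-f), and the bound below then only costs `c·ε₁² + √c·ε₁·(covariant gradient)` — BAŁABAN's SCALE `√c·ε₁ = ε₁∕η ≤ const` (PART Ϩ-e).  NOT Bałaban's multi-level `G_k(U)`;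
NOT a node discharge (N15 of record untouched); nothing continuum ∕ ℝ⁴ ∕ OS ∕ Clay.

THE RESULTS (`K` any period vector, fibre `𝕜ⁿ`, `c ≥ 0`; `E_{U₀}(v) = Σ_xΣ_μ‖v_x − U₀(x,μ)v_{x+e_μ}‖²` = PART Ϳ-a `bondE`):
* §1 ★ `cxHop_mulVec_apply` (the stencil of `T_{A,B}`), ★★ **`star_dotProduct_cxHop_mulVec`** (THE BILINEAR BOND EXPANSION `⟨w, T_{A,B}v⟩ = cΣ_{x,μ}(⟨w_x, A(x,μ)v_{x+e_μ}⟩ + ⟨w_{x+e_μ}, B(x,μ)v_x⟩)`).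
* §2 ONE BOND (unitary `a`, ANY `D₁, D₂`): ★★ **`bond_pair_identity₂`** (`⟨p,D₁q′⟩ + ⟨p′,D₂q⟩ = ⟨p,(D₁aᴴ + aD₂)q⟩ − ⟨p,D₁aᴴ(q − aq′)⟩ − ⟨p − ap′, aD₂q⟩` — the zeroth-order part is the DEFECT
  `D₁aᴴ + aD₂`, the rest pairs with COVARIANT DIFFERENCES), ★ `norm_bond_pair_le₂` (`‖D₁‖,‖D₂‖ ≤ ε₁`, `‖D₁aᴴ + aD₂‖ ≤ ε₂` ⟹ `≤ ε₂‖p‖‖q‖ + ε₁‖p‖‖q − aq′‖ + ε₁‖p − ap′‖‖q‖`).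
* §3 ★★★ **`norm_form_cxHop_le`** — THE `H¹` PERTURBATION BOUND: for unitary `U₀`, `‖δU_b‖,‖δV_b‖ ≤ ε₁`, `‖δU_bU₀_bᴴ + U₀_bδV_b‖ ≤ ε₂` on every bond, all `w, v`:
  `|⟨w, T_{δU,δV}v⟩| ≤ c(d+1)ε₂‖w‖‖v‖ + cε₁√(d+1)(‖w‖·E_{U₀}(v)^{1∕2} + E_{U₀}(w)^{1∕2}·‖v‖)`; ★★ **`norm_quadForm_cxHop_le_H1`** (the diagonal case `w = v`: `≤ c(d+1)ε₂N(v) + 2cε₁√(d+1)·N(v)^{1∕2}E_{U₀}(v)^{1∕2}`,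
  `N(v) = Σ_x‖v_x‖²`), ★★ **`norm_quadForm_cxHop_le_absorbed`** (`≤ c(d+1)(ε₂ + 2ε₁²∕θ)·N(v) + (θ∕2)·c·E_{U₀}(v)` for every `θ > 0` — half a gradient absorbs the first-order term; with `c = L²`
  the price is `(d+1)(L²ε₂ + 2(Lε₁)²∕θ)`: BAŁABAN's SCALE).
* §4 THE THREE CANONICAL DEFECTS: `norm_zeroth_two_sided_le` (`ε₂ ≤ 2ε₁` always — the two-sided window is first order, Ϛ-d), ★ `zeroth_unitary_slice` (unitary `U`: `(U−U₀)U₀ᴴ + U₀(Uᴴ−U₀ᴴ) =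
  −(U−U₀)(U−U₀)ᴴ`, so `ε₂ = ε₁²` — PART Ϧ-g∕Ϧ-h recovered), `norm_zeroth_unitary_slice_le`; print's slice `V = U⁻¹` (`ε₂ = ε₁²∕(1−ε₁)`) is PART Ϩ-f.
PRIOR TREE ART (by name): Ϧ-g (`norm_star_dotProduct_le_fibre`, `sum_mul_le_sqrt_mul_sqrt_univ`, `bond_pair_identity` (special case)), Ϛ-a (`cxHop`, `cxLapF`, `cxLapF_mulVec_apply`), Ϳ-a (`bondE`),
Ͱ-b∕Ͱ-f (`fib`, `sum_norm_fib_sq`, `sum_norm_fib_add_unitVec`, `l2_opNorm_of_mem_unitaryGroup_le`), Mathlib.  Dedup (rg at filing): basename 0 files; needles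
`star_dotProduct_cxHop_mulVec|bond_pair_identity₂|norm_form_cxHop_le|zeroth_unitary_slice` 0 tree files.  presearch: «relative form-boundedness of the first-order part of δ(−Δ_A) =
−(∇−iA)δA − δA(∇−iA) + O(δA²)» is textbook (Kato-type perturbation of magnetic Schrödinger forms); lattice covariant form with a unitary base field and an independent backward variable:
no statement found in the tree (needles above) — typed here.  Locators: [Balaban1985BackgroundPropagators] (3.23) p.394, (3.48)–(3.53) pp.398–400 (shape of the `U`-dependence estimates),
§3.B p.399 l.37–40; [King1986] (4.4) p.670.  0 `sorry`, 0 `def`.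
-/

noncomputable section
open scoped BigOperators ComplexConjugate ComplexOrder InnerProductSpace Matrix.Norms.L2Operator
open Finset Matrix WithLp

namespace Summit.QuantumFields.YangMills.BalabanUVNodes.N15KingModelRung.Analytic

open Literature.MathematicalPhysics.QuantumFieldTheory.Balaban1983to89.B5Prop11Plancherel (Tor unitVec)
open Summit.QuantumFields.YangMills.BalabanUVNodes.N15KingModelRung.Covariant
  (cxHop cxLapF cxLapF_mulVec_apply fib fib_apply sum_norm_fib_sq sum_norm_fib_add_unitVec l2_opNorm_of_mem_unitaryGroup_le)
open Summit.QuantumFields.YangMills.BalabanUVNodes.N15KingModelRung.Curvature (bondE)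
open Summit.QuantumFields.YangMills.BalabanUVNodes.N15KingModelRung.CombesThomas (norm_star_dotProduct_le_fibre sum_mul_le_sqrt_mul_sqrt_univ)

variable {d : ℕ} (K : Fin (d + 1) → ℕ) [hK : ∀ μ, NeZero (K μ)]
variable {𝕜 : Type*} [RCLike 𝕜] {n : Type*} [Fintype n] [DecidableEq n]

/-! ## §1 The bilinear bond expansion of the two-sided hopping matrix -/

section Bilinear

/-- ★ THE STENCIL OF THE TWO-SIDED HOPPING MATRIX: `(T_{A,B}v)(x,i) = cΣ_μ((A(x,μ)v(x+e_μ))_i + (B(x−e_μ,μ)v(x−e_μ))_i)`. [cite: Balaban1985BackgroundPropagators, (3.50) p.400; King1986, (4.4) p.670] -/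
theorem cxHop_mulVec_apply (c : ℝ) (A B : Tor K × Fin (d + 1) → Matrix n n 𝕜) (v : Tor K × n → 𝕜) (x : Tor K) (i : n) :
    (cxHop K c A B *ᵥ v) (x, i) = (c : 𝕜) * ∑ μ, ((A (x, μ) *ᵥ fun j => v (x + unitVec K μ, j)) i + (B (x - unitVec K μ, μ) *ᵥ fun j => v (x - unitVec K μ, j)) i) := by
  have h := cxLapF_mulVec_apply K c 0 A B v x i
  have h2 : (cxLapF K c 0 A B *ᵥ v) (x, i) = ((0 + 2 * ((d : ℝ) + 1) * c : ℝ) : 𝕜) * v (x, i) - (cxHop K c A B *ᵥ v) (x, i) := by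
    rw [cxLapF, Matrix.sub_mulVec, Pi.sub_apply, mulVec_diagonal]
  rw [h2] at h
  exact sub_right_injective h

/-- ★★ **THE BILINEAR BOND EXPANSION**: `⟨w, T_{A,B}v⟩ = c·Σ_{x,μ}(⟨w_x, A(x,μ)v_{x+e_μ}⟩ + ⟨w_{x+e_μ}, B(x,μ)v_x⟩)` (backward terms reindexed `x − e_μ ↦ x`).
[cite: Balaban1985BackgroundPropagators, (3.23) p.394, (3.50) p.400; King1986, (4.4) p.670] -/
theorem star_dotProduct_cxHop_mulVec (c : ℝ) (A B : Tor K × Fin (d + 1) → Matrix n n 𝕜) (w v : Tor K × n → 𝕜) :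
    star w ⬝ᵥ (cxHop K c A B *ᵥ v)
      = (c : 𝕜) * ∑ x, ∑ μ, (star (fun i => w (x, i)) ⬝ᵥ (A (x, μ) *ᵥ fun j => v (x + unitVec K μ, j))
          + star (fun i => w (x + unitVec K μ, i)) ⬝ᵥ (B (x, μ) *ᵥ fun j => v (x, j))) := by
  have hpt : ∀ x i, star (w (x, i)) * (cxHop K c A B *ᵥ v) (x, i)
      = (c : 𝕜) * (star (w (x, i)) * ∑ μ, (A (x, μ) *ᵥ fun j => v (x + unitVec K μ, j)) i)
        + (c : 𝕜) * (star (w (x, i)) * ∑ μ, (B (x - unitVec K μ, μ) *ᵥ fun j => v (x - unitVec K μ, j)) i) := fun x i => by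
    rw [cxHop_mulVec_apply, Finset.sum_add_distrib]; ring
  have hb : ∑ x, ∑ i, (c : 𝕜) * (star (w (x, i)) * ∑ μ, (A (x, μ) *ᵥ fun j => v (x + unitVec K μ, j)) i)
      = (c : 𝕜) * ∑ x, ∑ μ, star (fun i => w (x, i)) ⬝ᵥ (A (x, μ) *ᵥ fun j => v (x + unitVec K μ, j)) := by
    simp only [dotProduct, Pi.star_apply, Finset.mul_sum]
    exact Finset.sum_congr rfl fun x _ => Finset.sum_comm
  have hc' : ∑ x, ∑ i, (c : 𝕜) * (star (w (x, i)) * ∑ μ, (B (x - unitVec K μ, μ) *ᵥ fun j => v (x - unitVec K μ, j)) i)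
      = (c : 𝕜) * ∑ x, ∑ μ, star (fun i => w (x + unitVec K μ, i)) ⬝ᵥ (B (x, μ) *ᵥ fun j => v (x, j)) := by
    simp only [dotProduct, Pi.star_apply, Finset.mul_sum]
    have hre : ∀ μ : Fin (d + 1), ∑ x, ∑ i, (c : 𝕜) * (star (w (x, i)) * (B (x - unitVec K μ, μ) *ᵥ fun j => v (x - unitVec K μ, j)) i)
        = ∑ x, ∑ i, (c : 𝕜) * (star (w (x + unitVec K μ, i)) * (B (x, μ) *ᵥ fun j => v (x, j)) i) := fun μ =>
      (Fintype.sum_equiv (Equiv.addRight (unitVec K μ)) _ _ fun x => by simp only [Equiv.coe_addRight, add_sub_cancel_right]).symm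
    calc ∑ x, ∑ i, ∑ μ, (c : 𝕜) * (star (w (x, i)) * (B (x - unitVec K μ, μ) *ᵥ fun j => v (x - unitVec K μ, j)) i)
        = ∑ μ, ∑ x, ∑ i, (c : 𝕜) * (star (w (x, i)) * (B (x - unitVec K μ, μ) *ᵥ fun j => v (x - unitVec K μ, j)) i) :=
          (Finset.sum_congr rfl fun x _ => Finset.sum_comm).trans Finset.sum_comm
      _ = ∑ μ, ∑ x, ∑ i, (c : 𝕜) * (star (w (x + unitVec K μ, i)) * (B (x, μ) *ᵥ fun j => v (x, j)) i) := Finset.sum_congr rfl fun μ _ => hre μ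
      _ = ∑ x, ∑ μ, ∑ i, (c : 𝕜) * (star (w (x + unitVec K μ, i)) * (B (x, μ) *ᵥ fun j => v (x, j)) i) := Finset.sum_comm
  calc star w ⬝ᵥ (cxHop K c A B *ᵥ v) = ∑ x, ∑ i, star (w (x, i)) * (cxHop K c A B *ᵥ v) (x, i) := by
        simp only [dotProduct, Pi.star_apply, Fintype.sum_prod_type]
    _ = ∑ x, ∑ i, ((c : 𝕜) * (star (w (x, i)) * ∑ μ, (A (x, μ) *ᵥ fun j => v (x + unitVec K μ, j)) i)
          + (c : 𝕜) * (star (w (x, i)) * ∑ μ, (B (x - unitVec K μ, μ) *ᵥ fun j => v (x - unitVec K μ, j)) i)) :=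
        Finset.sum_congr rfl fun x _ => Finset.sum_congr rfl fun i _ => hpt x i
    _ = (∑ x, ∑ i, (c : 𝕜) * (star (w (x, i)) * ∑ μ, (A (x, μ) *ᵥ fun j => v (x + unitVec K μ, j)) i))
          + ∑ x, ∑ i, (c : 𝕜) * (star (w (x, i)) * ∑ μ, (B (x - unitVec K μ, μ) *ᵥ fun j => v (x - unitVec K μ, j)) i) := by
        simp only [Finset.sum_add_distrib]
    _ = _ := by rw [hb, hc', ← mul_add, ← Finset.sum_add_distrib]; simp only [← Finset.sum_add_distrib]

end Bilinear

/-! ## §2 One bond: the generalised bond-pair identity around a unitary `a` -/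

section OneBond

/-- ★★ **THE GENERALISED BOND-PAIR IDENTITY**: for a unitary `a` and ANY `D₁, D₂` (forward∕backward perturbations of one bond), and vectors `p, p′, q, q′` of one fibre:
`⟨p, D₁q′⟩ + ⟨p′, D₂q⟩ = ⟨p, (D₁aᴴ + aD₂)q⟩ − ⟨p, D₁aᴴ(q − aq′)⟩ − ⟨p − ap′, aD₂q⟩` — zeroth order = the DEFECT `D₁aᴴ + aD₂`; the rest pairs a perturbation with a COVARIANT DIFFERENCE.
(PART Ϧ-g `bond_pair_identity`: `D₁ = U − a`, `D₂ = (U − a)ᴴ`, `U` unitary, where the defect collapses to `DDᴴ`.) [cite: Balaban1985BackgroundPropagators, (3.23) p.394, (3.48)–(3.50) pp.398–400 (mechanism)] -/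
theorem bond_pair_identity₂ {a : Matrix n n 𝕜} (ha : a ∈ Matrix.unitaryGroup n 𝕜) (D₁ D₂ : Matrix n n 𝕜) (p p' q q' : n → 𝕜) :
    star p ⬝ᵥ (D₁ *ᵥ q') + star p' ⬝ᵥ (D₂ *ᵥ q)
      = star p ⬝ᵥ ((D₁ * aᴴ + a * D₂) *ᵥ q) - star p ⬝ᵥ ((D₁ * aᴴ) *ᵥ (q - a *ᵥ q')) - star (p - a *ᵥ p') ⬝ᵥ ((a * D₂) *ᵥ q) := by
  have haa : aᴴ * a = 1 := by simpa only [star_eq_conjTranspose] using Matrix.mem_unitaryGroup_iff'.mp ha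
  -- (1) `D₁q′ = (D₁aᴴ)(aq′)`
  have e1 : D₁ *ᵥ q' = (D₁ * aᴴ) *ᵥ (a *ᵥ q') := by rw [mulVec_mulVec, Matrix.mul_assoc, haa, Matrix.mul_one]
  -- (2) `⟨p′, D₂q⟩ = ⟨ap′, (aD₂)q⟩`
  have e2 : star p' ⬝ᵥ (D₂ *ᵥ q) = star (a *ᵥ p') ⬝ᵥ ((a * D₂) *ᵥ q) := by
    rw [star_mulVec, ← dotProduct_mulVec, mulVec_mulVec, ← Matrix.mul_assoc, haa, Matrix.one_mul]
  rw [e1, e2, show a *ᵥ q' = q - (q - a *ᵥ q') by abel, show a *ᵥ p' = p - (p - a *ᵥ p') by abel, Matrix.mulVec_sub, dotProduct_sub, star_sub, sub_dotProduct,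
    Matrix.add_mulVec, dotProduct_add]
  abel

/-- ★ **THE GENERALISED BOND-PAIR BOUND**: `‖D₁‖, ‖D₂‖ ≤ ε₁`, `‖D₁aᴴ + aD₂‖ ≤ ε₂` (unitary `a`) ⟹ `|⟨p,D₁q′⟩ + ⟨p′,D₂q⟩| ≤ ε₂‖p‖‖q‖ + ε₁‖p‖‖q − aq′‖ + ε₁‖p − ap′‖‖q‖`.
[cite: Balaban1985BackgroundPropagators, (3.48)–(3.50) pp.398–400 (mechanism)] -/
theorem norm_bond_pair_le₂ {a : Matrix n n 𝕜} (ha : a ∈ Matrix.unitaryGroup n 𝕜) {D₁ D₂ : Matrix n n 𝕜} {ε₁ ε₂ : ℝ} (h₁ : ‖D₁‖ ≤ ε₁) (h₂ : ‖D₂‖ ≤ ε₁) (h₀ : ‖D₁ * aᴴ + a * D₂‖ ≤ ε₂)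
    (p p' q q' : n → 𝕜) :
    ‖star p ⬝ᵥ (D₁ *ᵥ q') + star p' ⬝ᵥ (D₂ *ᵥ q)‖
      ≤ ε₂ * (‖(toLp 2 p : EuclideanSpace 𝕜 n)‖ * ‖(toLp 2 q : EuclideanSpace 𝕜 n)‖)
        + ε₁ * (‖(toLp 2 p : EuclideanSpace 𝕜 n)‖ * ‖(toLp 2 (q - a *ᵥ q') : EuclideanSpace 𝕜 n)‖)
        + ε₁ * (‖(toLp 2 (p - a *ᵥ p') : EuclideanSpace 𝕜 n)‖ * ‖(toLp 2 q : EuclideanSpace 𝕜 n)‖) := by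
  have hε0 : 0 ≤ ε₁ := (norm_nonneg _).trans h₁
  have ha1 : ‖a‖ ≤ 1 := l2_opNorm_of_mem_unitaryGroup_le ha
  have hDa : ‖D₁ * aᴴ‖ ≤ ε₁ := by
    calc ‖D₁ * aᴴ‖ ≤ ‖D₁‖ * ‖aᴴ‖ := norm_mul_le _ _
      _ ≤ ε₁ * 1 := by rw [Matrix.l2_opNorm_conjTranspose]; exact mul_le_mul h₁ ha1 (norm_nonneg _) hε0
      _ = ε₁ := mul_one ε₁
  have haD : ‖a * D₂‖ ≤ ε₁ := by
    calc ‖a * D₂‖ ≤ ‖a‖ * ‖D₂‖ := norm_mul_le _ _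
      _ ≤ 1 * ε₁ := mul_le_mul ha1 h₂ (norm_nonneg _) zero_le_one
      _ = ε₁ := one_mul ε₁
  rw [bond_pair_identity₂ ha]
  have b1 : ‖star p ⬝ᵥ ((D₁ * aᴴ + a * D₂) *ᵥ q)‖ ≤ ε₂ * (‖(toLp 2 p : EuclideanSpace 𝕜 n)‖ * ‖(toLp 2 q : EuclideanSpace 𝕜 n)‖) := by
    refine (norm_star_dotProduct_le_fibre _ _ _).trans ?_
    rw [mul_left_comm]
    exact mul_le_mul_of_nonneg_right h₀ (by positivity)
  have b2 : ‖star p ⬝ᵥ ((D₁ * aᴴ) *ᵥ (q - a *ᵥ q'))‖ ≤ ε₁ * (‖(toLp 2 p : EuclideanSpace 𝕜 n)‖ * ‖(toLp 2 (q - a *ᵥ q') : EuclideanSpace 𝕜 n)‖) := by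
    refine (norm_star_dotProduct_le_fibre _ _ _).trans ?_
    rw [mul_left_comm]
    exact mul_le_mul_of_nonneg_right hDa (by positivity)
  have b3 : ‖star (p - a *ᵥ p') ⬝ᵥ ((a * D₂) *ᵥ q)‖ ≤ ε₁ * (‖(toLp 2 (p - a *ᵥ p') : EuclideanSpace 𝕜 n)‖ * ‖(toLp 2 q : EuclideanSpace 𝕜 n)‖) := by
    refine (norm_star_dotProduct_le_fibre _ _ _).trans ?_
    rw [mul_left_comm]
    exact mul_le_mul_of_nonneg_right haD (by positivity)
  exact (norm_sub_le _ _).trans (add_le_add ((norm_sub_le _ _).trans (add_le_add b1 b2)) b3)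

end OneBond

/-! ## §3 The `H¹` perturbation bound -/

section Form

/-- ★★★ **THE `H¹` PERTURBATION BOUND**: for a unitary base field `U₀`, perturbation fields with `‖δU_b‖, ‖δV_b‖ ≤ ε₁` and zeroth-order defect `‖δU_bU₀_bᴴ + U₀_bδV_b‖ ≤ ε₂` on every bond,
`c ≥ 0`, and all `w, v`:  `|⟨w, T_{δU,δV}v⟩| ≤ c(d+1)ε₂‖w‖‖v‖ + cε₁√(d+1)·(‖w‖·E_{U₀}(v)^{1∕2} + E_{U₀}(w)^{1∕2}·‖v‖)`.
[cite: Balaban1985BackgroundPropagators, (3.23) p.394, (3.48)–(3.53) pp.398–400 (shape); King1986, (4.4) p.670] -/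
theorem norm_form_cxHop_le {c : ℝ} (hc : 0 ≤ c) {U₀ δU δV : Tor K × Fin (d + 1) → Matrix n n 𝕜} (hU₀ : ∀ b, U₀ b ∈ Matrix.unitaryGroup n 𝕜)
    {ε₁ ε₂ : ℝ} (h₁ : ∀ b, ‖δU b‖ ≤ ε₁) (h₂ : ∀ b, ‖δV b‖ ≤ ε₁) (h₀ : ∀ b, ‖δU b * (U₀ b)ᴴ + U₀ b * δV b‖ ≤ ε₂) (w v : Tor K × n → 𝕜) :
    ‖star w ⬝ᵥ (cxHop K c δU δV *ᵥ v)‖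
      ≤ c * ((d : ℝ) + 1) * ε₂ * (‖(toLp 2 w : EuclideanSpace 𝕜 (Tor K × n))‖ * ‖(toLp 2 v : EuclideanSpace 𝕜 (Tor K × n))‖)
        + c * ε₁ * Real.sqrt ((d : ℝ) + 1) * (‖(toLp 2 w : EuclideanSpace 𝕜 (Tor K × n))‖ * Real.sqrt (∑ x, ∑ μ, bondE K U₀ v x μ)
            + Real.sqrt (∑ x, ∑ μ, bondE K U₀ w x μ) * ‖(toLp 2 v : EuclideanSpace 𝕜 (Tor K × n))‖) := by
  classical
  rw [star_dotProduct_cxHop_mulVec, norm_mul, RCLike.norm_ofReal, abs_of_nonneg hc]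
  set Nw : ℝ := ‖(toLp 2 w : EuclideanSpace 𝕜 (Tor K × n))‖ with hNw
  set Nv : ℝ := ‖(toLp 2 v : EuclideanSpace 𝕜 (Tor K × n))‖ with hNv
  set dv : Tor K → Fin (d + 1) → ℝ := fun x μ => ‖fib K v x - Matrix.toEuclideanLin (U₀ (x, μ)) (fib K v (x + unitVec K μ))‖ with hdv
  set dw : Tor K → Fin (d + 1) → ℝ := fun x μ => ‖fib K w x - Matrix.toEuclideanLin (U₀ (x, μ)) (fib K w (x + unitVec K μ))‖ with hdw
  have hbv : ∀ x μ, bondE K U₀ v x μ = dv x μ ^ 2 := fun x μ => rfl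
  have hbw : ∀ x μ, bondE K U₀ w x μ = dw x μ ^ 2 := fun x μ => rfl
  have hε0 : 0 ≤ ε₁ := (norm_nonneg _).trans (h₁ (0, 0))
  -- per bond
  have hbond : ∀ x μ, ‖star (fun i => w (x, i)) ⬝ᵥ (δU (x, μ) *ᵥ fun j => v (x + unitVec K μ, j))
        + star (fun i => w (x + unitVec K μ, i)) ⬝ᵥ (δV (x, μ) *ᵥ fun j => v (x, j))‖
      ≤ ε₂ * (‖fib K w x‖ * ‖fib K v x‖) + ε₁ * (‖fib K w x‖ * dv x μ) + ε₁ * (dw x μ * ‖fib K v x‖) := by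
    intro x μ
    have h := norm_bond_pair_le₂ (hU₀ (x, μ)) (h₁ (x, μ)) (h₂ (x, μ)) (h₀ (x, μ)) (fun i => w (x, i)) (fun i => w (x + unitVec K μ, i)) (fun j => v (x, j)) (fun j => v (x + unitVec K μ, j))
    have e1 : (toLp 2 ((fun j => v (x, j)) - U₀ (x, μ) *ᵥ fun j => v (x + unitVec K μ, j)) : EuclideanSpace 𝕜 n)
        = fib K v x - Matrix.toEuclideanLin (U₀ (x, μ)) (fib K v (x + unitVec K μ)) := by
      rw [WithLp.toLp_sub, Matrix.toLpLin_apply]; rfl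
    have e2 : (toLp 2 ((fun i => w (x, i)) - U₀ (x, μ) *ᵥ fun i => w (x + unitVec K μ, i)) : EuclideanSpace 𝕜 n)
        = fib K w x - Matrix.toEuclideanLin (U₀ (x, μ)) (fib K w (x + unitVec K μ)) := by
      rw [WithLp.toLp_sub, Matrix.toLpLin_apply]; rfl
    rw [e1, e2] at h
    exact h
  -- sum the bonds
  have hsum1 : ∑ x, ∑ μ : Fin (d + 1), ‖fib K w x‖ * ‖fib K v x‖ ≤ ((d : ℝ) + 1) * (Nw * Nv) := by
    have h1 : ∑ x, ‖fib K w x‖ * ‖fib K v x‖ ≤ Nw * Nv := by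
      have h := sum_mul_le_sqrt_mul_sqrt_univ (fun x => ‖fib K w x‖) (fun x => ‖fib K v x‖)
      rwa [sum_norm_fib_sq, sum_norm_fib_sq, Real.sqrt_sq (norm_nonneg _), Real.sqrt_sq (norm_nonneg _)] at h
    simp only [Finset.sum_const, Finset.card_univ, Fintype.card_fin, nsmul_eq_mul]
    rw [← Finset.mul_sum]; push_cast; nlinarith
  have hsum2 : ∑ x, ∑ μ : Fin (d + 1), ‖fib K w x‖ * dv x μ ≤ Real.sqrt ((d : ℝ) + 1) * Nw * Real.sqrt (∑ x, ∑ μ, bondE K U₀ v x μ) := by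
    have h := sum_mul_le_sqrt_mul_sqrt_univ (fun xm : Tor K × Fin (d + 1) => ‖fib K w xm.1‖) (fun xm => dv xm.1 xm.2)
    rw [Fintype.sum_prod_type, Fintype.sum_prod_type, Fintype.sum_prod_type] at h
    simp only at h
    have hw2 : ∑ x : Tor K, ∑ _μ : Fin (d + 1), ‖fib K w x‖ ^ 2 = ((d : ℝ) + 1) * Nw ^ 2 := by
      simp only [Finset.sum_const, Finset.card_univ, Fintype.card_fin, nsmul_eq_mul]; rw [← Finset.mul_sum, sum_norm_fib_sq]; push_cast; ring
    rw [hw2, Real.sqrt_mul (by positivity), Real.sqrt_sq (norm_nonneg _)] at h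
    simp only [hbv]
    exact h
  have hsum3 : ∑ x, ∑ μ : Fin (d + 1), dw x μ * ‖fib K v x‖ ≤ Real.sqrt (∑ x, ∑ μ, bondE K U₀ w x μ) * (Real.sqrt ((d : ℝ) + 1) * Nv) := by
    have h := sum_mul_le_sqrt_mul_sqrt_univ (fun xm : Tor K × Fin (d + 1) => dw xm.1 xm.2) (fun xm => ‖fib K v xm.1‖)
    rw [Fintype.sum_prod_type, Fintype.sum_prod_type, Fintype.sum_prod_type] at h
    simp only at h
    have hv2 : ∑ x : Tor K, ∑ _μ : Fin (d + 1), ‖fib K v x‖ ^ 2 = ((d : ℝ) + 1) * Nv ^ 2 := by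
      simp only [Finset.sum_const, Finset.card_univ, Fintype.card_fin, nsmul_eq_mul]; rw [← Finset.mul_sum, sum_norm_fib_sq]; push_cast; ring
    rw [hv2, Real.sqrt_mul (by positivity), Real.sqrt_sq (norm_nonneg _)] at h
    simp only [hbw]
    exact h
  calc c * ‖∑ x, ∑ μ, (star (fun i => w (x, i)) ⬝ᵥ (δU (x, μ) *ᵥ fun j => v (x + unitVec K μ, j))
          + star (fun i => w (x + unitVec K μ, i)) ⬝ᵥ (δV (x, μ) *ᵥ fun j => v (x, j)))‖
      ≤ c * ∑ x, ∑ μ, (ε₂ * (‖fib K w x‖ * ‖fib K v x‖) + ε₁ * (‖fib K w x‖ * dv x μ) + ε₁ * (dw x μ * ‖fib K v x‖)) := by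
        refine mul_le_mul_of_nonneg_left ((norm_sum_le _ _).trans (Finset.sum_le_sum fun x _ => (norm_sum_le _ _).trans (Finset.sum_le_sum fun μ _ => hbond x μ))) hc
    _ = c * (ε₂ * ∑ x, ∑ μ : Fin (d + 1), ‖fib K w x‖ * ‖fib K v x‖ + ε₁ * ∑ x, ∑ μ : Fin (d + 1), ‖fib K w x‖ * dv x μ + ε₁ * ∑ x, ∑ μ : Fin (d + 1), dw x μ * ‖fib K v x‖) := by
        simp only [Finset.sum_add_distrib, Finset.mul_sum]
    _ ≤ c * (ε₂ * (((d : ℝ) + 1) * (Nw * Nv)) + ε₁ * (Real.sqrt ((d : ℝ) + 1) * Nw * Real.sqrt (∑ x, ∑ μ, bondE K U₀ v x μ))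
          + ε₁ * (Real.sqrt (∑ x, ∑ μ, bondE K U₀ w x μ) * (Real.sqrt ((d : ℝ) + 1) * Nv))) := by
        have hε2 : 0 ≤ ε₂ := (norm_nonneg _).trans (h₀ (0, 0))
        gcongr
    _ = _ := by ring

/-- ★★ **THE DIAGONAL CASE**: `|⟨v, T_{δU,δV}v⟩| ≤ c(d+1)ε₂·N(v) + 2cε₁√(d+1)·N(v)^{1∕2}·E_{U₀}(v)^{1∕2}`, `N(v) = Σ_x‖v_x‖²`.
[cite: Balaban1985BackgroundPropagators, (3.48)–(3.53) pp.398–400 (shape)] -/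
theorem norm_quadForm_cxHop_le_H1 {c : ℝ} (hc : 0 ≤ c) {U₀ δU δV : Tor K × Fin (d + 1) → Matrix n n 𝕜} (hU₀ : ∀ b, U₀ b ∈ Matrix.unitaryGroup n 𝕜)
    {ε₁ ε₂ : ℝ} (h₁ : ∀ b, ‖δU b‖ ≤ ε₁) (h₂ : ∀ b, ‖δV b‖ ≤ ε₁) (h₀ : ∀ b, ‖δU b * (U₀ b)ᴴ + U₀ b * δV b‖ ≤ ε₂) (v : Tor K × n → 𝕜) :
    ‖star v ⬝ᵥ (cxHop K c δU δV *ᵥ v)‖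
      ≤ c * ((d : ℝ) + 1) * ε₂ * ∑ x, ‖fib K v x‖ ^ 2
        + 2 * c * ε₁ * Real.sqrt ((d : ℝ) + 1) * (Real.sqrt (∑ x, ‖fib K v x‖ ^ 2) * Real.sqrt (∑ x, ∑ μ, bondE K U₀ v x μ)) := by
  have h := norm_form_cxHop_le K hc hU₀ h₁ h₂ h₀ v v
  have hN0 : 0 ≤ ∑ x, ‖fib K v x‖ ^ 2 := Finset.sum_nonneg fun _ _ => sq_nonneg _
  have hN : ‖(toLp 2 v : EuclideanSpace 𝕜 (Tor K × n))‖ = Real.sqrt (∑ x, ‖fib K v x‖ ^ 2) := by rw [sum_norm_fib_sq, Real.sqrt_sq (norm_nonneg _)]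
  rw [hN] at h
  calc _ ≤ _ := h
    _ = _ := by rw [Real.mul_self_sqrt hN0]; ring

/-- ★★ **ABSORPTION BY HALF A GRADIENT**: for every `θ > 0`,
`|⟨v, T_{δU,δV}v⟩| ≤ c(d+1)(ε₂ + 2ε₁²∕θ)·N(v) + (θ∕2)·c·E_{U₀}(v)` (AM–GM on the first-order term) — with King's scaling `c = L²` the price of the perturbation is
`(d+1)(L²ε₂ + 2(Lε₁)²∕θ)` per unit field plus `θ∕2` of the covariant gradient energy: BAŁABAN's SCALE `Lε₁ = ε₁∕η = O(1)`, `L²ε₂ = O(1)`.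
[cite: Balaban1985BackgroundPropagators, Thm 3.4 p.400, (3.48)–(3.53) pp.398–400 (shape)] -/
theorem norm_quadForm_cxHop_le_absorbed {c : ℝ} (hc : 0 ≤ c) {U₀ δU δV : Tor K × Fin (d + 1) → Matrix n n 𝕜} (hU₀ : ∀ b, U₀ b ∈ Matrix.unitaryGroup n 𝕜)
    {ε₁ ε₂ : ℝ} (h₁ : ∀ b, ‖δU b‖ ≤ ε₁) (h₂ : ∀ b, ‖δV b‖ ≤ ε₁) (h₀ : ∀ b, ‖δU b * (U₀ b)ᴴ + U₀ b * δV b‖ ≤ ε₂) {θ : ℝ} (hθ : 0 < θ) (v : Tor K × n → 𝕜) :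
    ‖star v ⬝ᵥ (cxHop K c δU δV *ᵥ v)‖
      ≤ c * ((d : ℝ) + 1) * (ε₂ + 2 * ε₁ ^ 2 / θ) * ∑ x, ‖fib K v x‖ ^ 2 + θ / 2 * (c * ∑ x, ∑ μ, bondE K U₀ v x μ) := by
  have h := norm_quadForm_cxHop_le_H1 K hc hU₀ h₁ h₂ h₀ v
  set N : ℝ := ∑ x, ‖fib K v x‖ ^ 2 with hN
  set E : ℝ := ∑ x, ∑ μ, bondE K U₀ v x μ with hE
  have hN0 : 0 ≤ N := Finset.sum_nonneg fun _ _ => sq_nonneg _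
  have hE0 : 0 ≤ E := Finset.sum_nonneg fun _ _ => Finset.sum_nonneg fun _ _ => by rw [bondE]; exact sq_nonneg _
  have hε0 : 0 ≤ ε₁ := (norm_nonneg _).trans (h₁ (0, 0))
  -- AM–GM: `2ε₁√(d+1)√N√E ≤ 2(d+1)ε₁²N∕θ + (θ∕2)E`
  have hamgm : 2 * ε₁ * Real.sqrt ((d : ℝ) + 1) * (Real.sqrt N * Real.sqrt E) ≤ ((d : ℝ) + 1) * (2 * ε₁ ^ 2 / θ) * N + θ / 2 * E := by
    have hsq : (Real.sqrt ((d : ℝ) + 1) * Real.sqrt N) ^ 2 = ((d : ℝ) + 1) * N := by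
      rw [mul_pow, Real.sq_sqrt (by positivity), Real.sq_sqrt hN0]
    have hsqE : Real.sqrt E ^ 2 = E := Real.sq_sqrt hE0
    -- `2ab ≤ (2∕θ)a² + (θ∕2)b²` with `a = ε₁√(d+1)√N`, `b = √E`
    have key : ∀ a b : ℝ, 2 * a * b ≤ (2 / θ) * a ^ 2 + θ / 2 * b ^ 2 := by
      intro a b
      have h1 : 0 ≤ (2 / θ) * (a - θ / 2 * b) ^ 2 := by positivity
      have h2 : (2 / θ) * (a - θ / 2 * b) ^ 2 = (2 / θ) * a ^ 2 - 2 * a * b + θ / 2 * b ^ 2 := by field_simp; ring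
      linarith
    have h3 := key (ε₁ * (Real.sqrt ((d : ℝ) + 1) * Real.sqrt N)) (Real.sqrt E)
    rw [mul_pow, hsq, hsqE] at h3
    calc 2 * ε₁ * Real.sqrt ((d : ℝ) + 1) * (Real.sqrt N * Real.sqrt E) = 2 * (ε₁ * (Real.sqrt ((d : ℝ) + 1) * Real.sqrt N)) * Real.sqrt E := by ring
      _ ≤ 2 / θ * (ε₁ ^ 2 * (((d : ℝ) + 1) * N)) + θ / 2 * E := h3
      _ = ((d : ℝ) + 1) * (2 * ε₁ ^ 2 / θ) * N + θ / 2 * E := by ring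
  calc ‖star v ⬝ᵥ (cxHop K c δU δV *ᵥ v)‖ ≤ c * ((d : ℝ) + 1) * ε₂ * N + 2 * c * ε₁ * Real.sqrt ((d : ℝ) + 1) * (Real.sqrt N * Real.sqrt E) := h
    _ = c * ((d : ℝ) + 1) * ε₂ * N + c * (2 * ε₁ * Real.sqrt ((d : ℝ) + 1) * (Real.sqrt N * Real.sqrt E)) := by ring
    _ ≤ c * ((d : ℝ) + 1) * ε₂ * N + c * (((d : ℝ) + 1) * (2 * ε₁ ^ 2 / θ) * N + θ / 2 * E) := by gcongr
    _ = _ := by ring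

end Form

/-! ## §4 The canonical zeroth-order defects -/

section Defects

omit hK in
/-- THE TWO-SIDED DEFECT IS FIRST ORDER: `‖δU_bU₀_bᴴ + U₀_bδV_b‖ ≤ ‖δU_b‖ + ‖δV_b‖` (unitary `U₀_b`) — nothing cancels for independent forward∕backward perturbations (PART Ϛ-d: the two-sided
window is SHARP at first order). [cite: Balaban1985BackgroundPropagators, Thm 3.4 p.400] -/
theorem norm_zeroth_two_sided_le {U₀ : Matrix n n 𝕜} (hU₀ : U₀ ∈ Matrix.unitaryGroup n 𝕜) (D₁ D₂ : Matrix n n 𝕜) : ‖D₁ * U₀ᴴ + U₀ * D₂‖ ≤ ‖D₁‖ + ‖D₂‖ := by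
  have h1 : ‖U₀‖ ≤ 1 := l2_opNorm_of_mem_unitaryGroup_le hU₀
  refine (norm_add_le _ _).trans (add_le_add ?_ ?_)
  · calc ‖D₁ * U₀ᴴ‖ ≤ ‖D₁‖ * ‖U₀ᴴ‖ := norm_mul_le _ _
      _ ≤ ‖D₁‖ * 1 := by rw [Matrix.l2_opNorm_conjTranspose]; exact mul_le_mul_of_nonneg_left h1 (norm_nonneg _)
      _ = ‖D₁‖ := mul_one _
  · calc ‖U₀ * D₂‖ ≤ ‖U₀‖ * ‖D₂‖ := norm_mul_le _ _
      _ ≤ 1 * ‖D₂‖ := mul_le_mul_of_nonneg_right h1 (norm_nonneg _)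
      _ = ‖D₂‖ := one_mul _

omit hK in
/-- ★ **ON THE UNITARY SLICE THE DEFECT IS SECOND ORDER**: for unitary `U, U₀`, `(U − U₀)U₀ᴴ + U₀(Uᴴ − U₀ᴴ) = −(U − U₀)(U − U₀)ᴴ` (PART Ϧ-g's `DUᴴ + UDᴴ = DDᴴ` about the base point).
[cite: Balaban1985BackgroundPropagators, (3.48) p.398 (mechanism)] -/
theorem zeroth_unitary_slice {U U₀ : Matrix n n 𝕜} (hU : U ∈ Matrix.unitaryGroup n 𝕜) (hU₀ : U₀ ∈ Matrix.unitaryGroup n 𝕜) :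
    (U - U₀) * U₀ᴴ + U₀ * (Uᴴ - U₀ᴴ) = -((U - U₀) * (U - U₀)ᴴ) := by
  have hUU : U * Uᴴ = 1 := by simpa only [star_eq_conjTranspose] using Matrix.mem_unitaryGroup_iff.mp hU
  have h00 : U₀ * U₀ᴴ = 1 := by simpa only [star_eq_conjTranspose] using Matrix.mem_unitaryGroup_iff.mp hU₀
  rw [conjTranspose_sub, sub_mul, mul_sub, mul_sub, sub_mul, sub_mul, hUU, h00]; abel

omit hK in
/-- `‖U_b − U₀_b‖ ≤ ε` (both unitary) ⟹ the unitary-slice defect is `≤ ε²`. [cite: Balaban1985BackgroundPropagators, (3.48) p.398 (mechanism)] -/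
theorem norm_zeroth_unitary_slice_le {U U₀ : Matrix n n 𝕜} (hU : U ∈ Matrix.unitaryGroup n 𝕜) (hU₀ : U₀ ∈ Matrix.unitaryGroup n 𝕜) {ε : ℝ} (hε : ‖U - U₀‖ ≤ ε) :
    ‖(U - U₀) * U₀ᴴ + U₀ * (Uᴴ - U₀ᴴ)‖ ≤ ε ^ 2 := by
  have hε0 : 0 ≤ ε := (norm_nonneg _).trans hε
  rw [zeroth_unitary_slice hU hU₀, norm_neg]
  calc ‖(U - U₀) * (U - U₀)ᴴ‖ ≤ ‖U - U₀‖ * ‖(U - U₀)ᴴ‖ := norm_mul_le _ _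
    _ ≤ ε * ε := by rw [Matrix.l2_opNorm_conjTranspose]; exact mul_le_mul hε hε (norm_nonneg _) hε0
    _ = ε ^ 2 := by ring

end Defects


end Summit.QuantumFields.YangMills.BalabanUVNodes.N15KingModelRung.Analytic

end
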